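import Summits.CriticalPhenomena.PercolationContinuityZ3.Theorems.PercNearOneGluingNoHeavyLowerTailAPLNonuniformFibres
import HarnessLib

/-!
# `NoHeavyLowerTail` (stmt-CriticalPhenomena-4575) — the van den Berg–Häggström–Kahn slack for an apex SET:
# `P(S|b|c) · P(b ↔ c, no b–c path avoiding S) ≤ P(Sb|c) · P(Sc|b)` (glued apex)

Support file (prover seat `prim-cert-1`, gen 16; `--supports stmt-CriticalPhenomena-4575`; memo
`run/shared/lean/prim/prim-cert-1/FROM-prim-cert-1-g16-APL-NONUNIFORM.md`).  No definitions, no named facts, no sorries.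
Companion of `…APLNonuniformStep` (algebra) and `…APLNonuniform` (the induction).

SETTING.  `μ = prodBernoulli w` on the pairs of `Fin n`; a vertex set `S` (the apex, thought of as GLUED: the apex reaches
`x` iff `S ↔ x := ∃ s ∈ S, s ↔ x`) and two targets `b, c ∉ S`, `b ≠ c`.  `T_b(ω)` = the open cluster of `b` among the pairs
inside `Sᶜ` (`openCluster (ω ∩ {e | ∀ x ∈ e, x ∉ S}) b`).  Cells (glued): `u0 = μ(S ↮ b, S ↮ c, b ↮ c)`, `uab = μ(S ↔ b, S ↮ c)`,
`uac = μ(S ↔ c, S ↮ b)`, and the "apex-pivotal" mass `y = μ(c ∉ T_b, b ↔ c ∨ (S ↔ b ∧ S ↔ c))` = the configurations in which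
`b` and `c` are separated off `S` but joined through the glued apex.

**Theorem (`APL.apexSet_bhk_slack`).**  `u0 · y ≤ uab · uac`.
For `S = {a}` this is prove-5 g37's (A) / prim-ineq-gen-2's BHK slack `S = u₁u₂ − q·n ≥ 0` (`…CubicThreePointApexDecoupled`);
the set version is what the no-contraction induction of `…APLNonuniform` consumes (the merged apex of Kozma–Nitzan / prove-5 is a
glued SET on a fixed vertex type).

PROOF.  (1) Paths: `S ↔ b ⟺ EX_b := ∃ s ∈ S, t ∈ T_b(ω), {s,t} open` (last exit from `S`), and on `{c ∉ T_b}`,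
`b ↔ c ∨ (S↔b ∧ S↔c) ⟺ EX_b ∧ EX_c`; so with `D° = {c ∉ T_b}`, `m = μ(D°)`, `A = μ(D° ∩ EX_b)`, `G = μ(D° ∩ EX_c)`, `X = μ(D° ∩ EX_b ∩ EX_c)`:
`uab = A − X`, `uac = G − X`, `u0 = m − A − G + X`, `y = X`, and `u0·y − uab·uac = m·X − A·G`.  (2) Fibres: on `{T_b = T}` (`c ∉ T`) the
cluster `T_c` is the cluster of `c` among the pairs inside `Sᶜ ∖ T`, and `{T_b = T}`, `{S has an open pair into T}`,
`{S has an open pair into T_c}` are determined by three pairwise disjoint classes of pairs, so (cluster Markov property)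
`A = Σ_T p_T α(T)`, `G = Σ_T p_T Γ(T)`, `X = Σ_T p_T α(T)Γ(T)`, `m = Σ_T p_T` with `α` monotone, `Γ` antitone in `T`.  (3) In the model
`μ°` with the pairs meeting `S` given weight `0`, `p_T·1[c ∉ T] = μ°(b ↮ c, C(b) = T)`, so `m·X ≤ A·G` is van den Berg–Häggström–Kahn 2006
Thm. 1.3 (monotone × antitone, given `b ↮ c`) in the finite-sum form of the tree (`offObs_bhk_mono_anti`,
from `BHK2006_clusterConditionalPositiveAssociation_holds`).
[cite: VandenbergHaggstromKahn2005, Thm. 1.3 (p. 6), Thm. 1.4 (p. 7)]  [this work]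
-/
noncomputable section

namespace Summit.CriticalPhenomena.PercolationContinuityZ3.Theorems

namespace APL

open MeasureTheory Literature.Probability.Percolation Literature.Probability.LatticeModels
open scoped Classical

section Main

variable {n : ℕ} (w : Sym2 (Fin n) → unitInterval) (S : Finset (Fin n)) (b c : Fin n)

/-! ### The model with the pairs meeting `S` closed, and BHK in finite-sum form -/

/-- Under the weights `w° = w·1[pair inside Sᶜ]`, almost surely `ω ∩ {pairs inside Sᶜ} = ω`. [folklore] -/
theorem ae_inter_offS_eq :
    (prodBernoulli fun e : Sym2 (Fin n) => if (∀ x ∈ e, x ∉ (S : Set (Fin n))) then w e else 0)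
      {ω | ω ∩ {e | ∀ x ∈ e, x ∉ (S : Set (Fin n))} = ω}ᶜ = 0 := by
  have h : ∀ e : Sym2 (Fin n), ∀ᵐ ω ∂(prodBernoulli fun e : Sym2 (Fin n) =>
      if (∀ x ∈ e, x ∉ (S : Set (Fin n))) then w e else 0), e ∈ ω → ∀ x ∈ e, x ∉ (S : Set (Fin n)) := by
    intro e
    by_cases he : ∀ x ∈ e, x ∉ (S : Set (Fin n))
    · exact Filter.Eventually.of_forall fun ω _ => he
    · have h0 : (fun e : Sym2 (Fin n) => if (∀ x ∈ e, x ∉ (S : Set (Fin n))) then w e else 0) e = 0 := by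
        show (if (∀ x ∈ e, x ∉ (S : Set (Fin n))) then w e else 0) = 0
        rw [if_neg he]
      filter_upwards [prodBernoulli_ae_notMem (fun e : Sym2 (Fin n) =>
        if (∀ x ∈ e, x ∉ (S : Set (Fin n))) then w e else 0) h0] with ω hω
      exact fun h => absurd h hω
  have hae : ∀ᵐ ω ∂(prodBernoulli fun e : Sym2 (Fin n) => if (∀ x ∈ e, x ∉ (S : Set (Fin n))) then w e else 0),
      ω ∩ {e | ∀ x ∈ e, x ∉ (S : Set (Fin n))} = ω := by
    filter_upwards [ae_all_iff.2 h] with ω hω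
    ext e
    exact ⟨fun h => h.1, fun h => ⟨h, hω e h⟩⟩
  rw [ae_iff] at hae
  simpa only [Set.compl_setOf] using hae

/-- In the model `w°`: `μ°(b ↮ c, C(b) = T) = μ_w(T_b = T, c ∉ T_b)` (the fibres of `T_b` under `w`). [this work] -/
theorem real_offModel_fib (T : Finset (Fin n)) :
    (prodBernoulli fun e : Sym2 (Fin n) => if (∀ x ∈ e, x ∉ (S : Set (Fin n))) then w e else 0).real
        ({ω : BondConfig (Fin n) | ∀ x ∈ ({c} : Set (Fin n)), ¬ (openGraph ω).Reachable b x} ∩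
          {ω : BondConfig (Fin n) | openCluster ω b = (T : Set (Fin n))}) =
      (prodBernoulli w).real
          ({ω : BondConfig (Fin n) | openCluster (ω ∩ {e | ∀ x ∈ e, x ∉ (S : Set (Fin n))}) b = (T : Set (Fin n))} ∩
            {ω | c ∉ openCluster (ω ∩ {e | ∀ x ∈ e, x ∉ (S : Set (Fin n))}) b}) := by
  set μ0 := (prodBernoulli fun e : Sym2 (Fin n) => if (∀ x ∈ e, x ∉ (S : Set (Fin n))) then w e else 0) with hμ0
  have hN := ae_inter_offS_eq w S
  -- intersect with the full-measure set `N = {ω ∩ offS = ω}` on which the two events agree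
  have h1 : μ0.real ({ω : BondConfig (Fin n) | ∀ x ∈ ({c} : Set (Fin n)), ¬ (openGraph ω).Reachable b x} ∩
          {ω : BondConfig (Fin n) | openCluster ω b = (T : Set (Fin n))}) =
      μ0.real ({ω : BondConfig (Fin n) | openCluster (ω ∩ {e | ∀ x ∈ e, x ∉ (S : Set (Fin n))}) b = (T : Set (Fin n))} ∩
            {ω | c ∉ openCluster (ω ∩ {e | ∀ x ∈ e, x ∉ (S : Set (Fin n))}) b}) := by
    rw [measureReal_def, measureReal_def, ← measure_inter_conull hN, ← measure_inter_conull (μ := μ0)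
      (s := {ω : BondConfig (Fin n) | openCluster (ω ∩ {e | ∀ x ∈ e, x ∉ (S : Set (Fin n))}) b = (T : Set (Fin n))} ∩
            {ω | c ∉ openCluster (ω ∩ {e | ∀ x ∈ e, x ∉ (S : Set (Fin n))}) b}) hN]
    congr 2
    ext ω
    simp only [Set.mem_inter_iff, Set.mem_setOf_eq, Set.mem_singleton_iff, forall_eq]
    constructor
    · rintro ⟨⟨h1, h2⟩, hω⟩
      rw [hω]
      exact ⟨⟨h2, h1⟩, rfl⟩
    · rintro ⟨⟨h1, h2⟩, hω⟩
      rw [hω] at h1 h2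
      exact ⟨⟨h2, h1⟩, hω⟩
  rw [h1]
  -- agreement of the two weightings on events determined by the pairs inside `Sᶜ`
  refine prodBernoulli_real_eq_of_determinedBy _ w (F := {e : Sym2 (Fin n) | ∀ x ∈ e, x ∉ (S : Set (Fin n))})
    (fun e he => ?_) ?_ MeasurableSet.of_discrete
  · show (if (∀ x ∈ e, x ∉ (S : Set (Fin n))) then w e else 0) = w e
    rw [if_pos (show (∀ x ∈ e, x ∉ (S : Set (Fin n))) from he)]
  · rw [determinedBy_iff]
    intro ω ω' hω
    simp only [Set.mem_inter_iff, Set.mem_setOf_eq]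
    rw [hω]

/-- In the model `w°`: `μ°(b ↮ c) = μ_w(c ∉ T_b)`. [this work] -/
theorem real_offModel_notReach :
    (prodBernoulli fun e : Sym2 (Fin n) => if (∀ x ∈ e, x ∉ (S : Set (Fin n))) then w e else 0).real
        {ω : BondConfig (Fin n) | ∀ x ∈ ({c} : Set (Fin n)), ¬ (openGraph ω).Reachable b x} =
      (prodBernoulli w).real {ω : BondConfig (Fin n) | c ∉ openCluster (ω ∩ {e | ∀ x ∈ e, x ∉ (S : Set (Fin n))}) b} := by
  set μ0 := (prodBernoulli fun e : Sym2 (Fin n) => if (∀ x ∈ e, x ∉ (S : Set (Fin n))) then w e else 0) with hμ0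
  have hN := ae_inter_offS_eq w S
  have h1 : μ0.real {ω : BondConfig (Fin n) | ∀ x ∈ ({c} : Set (Fin n)), ¬ (openGraph ω).Reachable b x} =
      μ0.real {ω : BondConfig (Fin n) | c ∉ openCluster (ω ∩ {e | ∀ x ∈ e, x ∉ (S : Set (Fin n))}) b} := by
    rw [measureReal_def, measureReal_def, ← measure_inter_conull hN, ← measure_inter_conull (μ := μ0)
      (s := {ω : BondConfig (Fin n) | c ∉ openCluster (ω ∩ {e | ∀ x ∈ e, x ∉ (S : Set (Fin n))}) b}) hN]
    congr 2
    ext ω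
    simp only [Set.mem_inter_iff, Set.mem_setOf_eq, Set.mem_singleton_iff, forall_eq]
    constructor
    · rintro ⟨h1, hω⟩
      rw [hω]
      exact ⟨h1, rfl⟩
    · rintro ⟨h1, hω⟩
      rw [hω] at h1
      exact ⟨h1, hω⟩
  rw [h1]
  refine prodBernoulli_real_eq_of_determinedBy _ w (F := {e : Sym2 (Fin n) | ∀ x ∈ e, x ∉ (S : Set (Fin n))})
    (fun e he => ?_) ?_ MeasurableSet.of_discrete
  · show (if (∀ x ∈ e, x ∉ (S : Set (Fin n))) then w e else 0) = w e
    rw [if_pos (show (∀ x ∈ e, x ∉ (S : Set (Fin n))) from he)]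
  · rw [determinedBy_iff]
    intro ω ω' hω
    simp only [Set.mem_setOf_eq]
    rw [hω]

/-- **BHK Thm. 1.3 for the fibres of `T_b`**: with `p_T = μ(T_b = T, c ∉ T_b)`, `m = μ(c ∉ T_b)`, `α` monotone, `Γ` antitone,
`m · Σ_T α(T)Γ(T) p_T ≤ (Σ_T α(T) p_T)(Σ_T Γ(T) p_T)`. [cite: VandenbergHaggstromKahn2005, Thm. 1.3 (p. 6)] -/
theorem bhk_fibS (hbc : b ≠ c) (α Γ : Finset (Fin n) → ℝ) (hα : Monotone α) (hΓ : Antitone Γ) :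
    (prodBernoulli w).real {ω : BondConfig (Fin n) | c ∉ openCluster (ω ∩ {e | ∀ x ∈ e, x ∉ (S : Set (Fin n))}) b} *
        ∑ T : Finset (Fin n), (α T * Γ T) * (prodBernoulli w).real
          ({ω : BondConfig (Fin n) | openCluster (ω ∩ {e | ∀ x ∈ e, x ∉ (S : Set (Fin n))}) b = (T : Set (Fin n))} ∩
            {ω | c ∉ openCluster (ω ∩ {e | ∀ x ∈ e, x ∉ (S : Set (Fin n))}) b}) ≤
      (∑ T : Finset (Fin n), α T * (prodBernoulli w).real
          ({ω : BondConfig (Fin n) | openCluster (ω ∩ {e | ∀ x ∈ e, x ∉ (S : Set (Fin n))}) b = (T : Set (Fin n))} ∩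
            {ω | c ∉ openCluster (ω ∩ {e | ∀ x ∈ e, x ∉ (S : Set (Fin n))}) b})) *
        ∑ T : Finset (Fin n), Γ T * (prodBernoulli w).real
          ({ω : BondConfig (Fin n) | openCluster (ω ∩ {e | ∀ x ∈ e, x ∉ (S : Set (Fin n))}) b = (T : Set (Fin n))} ∩
            {ω | c ∉ openCluster (ω ∩ {e | ∀ x ∈ e, x ∉ (S : Set (Fin n))}) b}) := by
  have hs : b ∉ ({c} : Set (Fin n)) := fun h => hbc (Set.mem_singleton_iff.1 h)
  have key := offObs_bhk_mono_anti (fun e : Sym2 (Fin n) => if (∀ x ∈ e, x ∉ (S : Set (Fin n))) then w e else 0)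
    b ({c} : Set (Fin n)) hs α Γ hα hΓ
  simp only [real_offModel_fib w S b c, real_offModel_notReach w S b c] at key
  exact key

/-! ### The theorem -/

/-- **van den Berg–Häggström–Kahn slack for a glued apex SET.**  For `b, c ∉ S`, `b ≠ c`:
`μ(S ↮ b, S ↮ c, b ↮ c) · μ(c ∉ T_b, b ↔ c ∨ (S ↔ b ∧ S ↔ c)) ≤ μ(S ↔ b, S ↮ c) · μ(S ↔ c, S ↮ b)`,
where `S ↔ x := ∃ s ∈ S, s ↔ x` and `T_b` is the cluster of `b` among the pairs inside `Sᶜ`.  For `S = {a}` this is the BHK slack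
`u0 · P(abc, b ↮ c off a) ≤ uab · uac` of the apex-pair programme. [this work] -/
theorem apexSet_bhk_slack (hb : b ∉ S) (hc : c ∉ S) (hbc : b ≠ c) :
    (prodBernoulli w).real ({ω : BondConfig (Fin n) | ∃ s ∈ (S : Set (Fin n)), ω ∈ openConn s b}ᶜ ∩
          {ω | ∃ s ∈ (S : Set (Fin n)), ω ∈ openConn s c}ᶜ ∩ (openConn b c)ᶜ) *
        (prodBernoulli w).real ({ω : BondConfig (Fin n) | c ∉ openCluster (ω ∩ {e | ∀ x ∈ e, x ∉ (S : Set (Fin n))}) b} ∩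
          (openConn b c ∪ ({ω | ∃ s ∈ (S : Set (Fin n)), ω ∈ openConn s b} ∩
            {ω | ∃ s ∈ (S : Set (Fin n)), ω ∈ openConn s c}))) ≤
      (prodBernoulli w).real ({ω : BondConfig (Fin n) | ∃ s ∈ (S : Set (Fin n)), ω ∈ openConn s b} ∩
          {ω | ∃ s ∈ (S : Set (Fin n)), ω ∈ openConn s c}ᶜ) *
        (prodBernoulli w).real ({ω : BondConfig (Fin n) | ∃ s ∈ (S : Set (Fin n)), ω ∈ openConn s c} ∩
          {ω | ∃ s ∈ (S : Set (Fin n)), ω ∈ openConn s b}ᶜ) := by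
  have hbS : b ∉ (S : Set (Fin n)) := fun h => hb (Finset.mem_coe.1 h)
  have hcS : c ∉ (S : Set (Fin n)) := fun h => hc (Finset.mem_coe.1 h)
  have hm : ∀ A : Set (BondConfig (Fin n)), MeasurableSet A := fun A => MeasurableSet.of_discrete
  -- the four sums
  have hX := real_offD_exb_exc_eq_sum w S b c hb hc
  have hA := real_offD_exb_eq_sum w S b c hb
  have hG := real_offD_exc_eq_sum w S b c hb hc
  -- BHK
  have hα : Monotone fun T : Finset (Fin n) =>
      (prodBernoulli w).real {ω : BondConfig (Fin n) | ∃ s ∈ (S : Set (Fin n)), ∃ t ∈ (T : Set (Fin n)), s(s, t) ∈ ω} := by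
    intro T T' hTT'
    refine measureReal_mono ?_
    rintro ω ⟨s, hs, t, ht, hst⟩
    exact ⟨s, hs, t, Finset.mem_coe.2 (hTT' (Finset.mem_coe.1 ht)), hst⟩
  have hΓ : Antitone fun T : Finset (Fin n) =>
      (prodBernoulli w).real {ω : BondConfig (Fin n) | ∃ s ∈ (S : Set (Fin n)), ∃ t ∈ openCluster
        (ω ∩ {e | ∀ x ∈ e, x ∉ (S : Set (Fin n))} ∩ {e | ∀ x ∈ e, x ∉ (T : Set (Fin n))}) c, s(s, t) ∈ ω} := by
    intro T T' hTT'
    refine measureReal_mono ?_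
    rintro ω ⟨s, hs, t, ht, hst⟩
    refine ⟨s, hs, t, openCluster_mono ?_ c ht, hst⟩
    rintro e ⟨he1, he2⟩
    exact ⟨he1, fun x hx hxT => he2 x hx (Finset.mem_coe.2 (hTT' (Finset.mem_coe.1 hxT)))⟩
  have key := bhk_fibS w S b c hbc _ _ hα hΓ
  rw [← hX, ← hA, ← hG] at key
  -- cells in terms of m, A, G, X
  rw [cell_0_eq (S : Set (Fin n)) b c hbS hcS, cell_y_eq (S : Set (Fin n)) b c hbS hcS,
    cell_ab_eq (S : Set (Fin n)) b c hbS hcS, cell_ab_eq (S : Set (Fin n)) c b hcS hbS]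
  -- abbreviations
  set D0 : Set (BondConfig (Fin n)) := {ω | c ∉ openCluster (ω ∩ {e | ∀ x ∈ e, x ∉ (S : Set (Fin n))}) b} with hD0
  set EXb : Set (BondConfig (Fin n)) :=
    {ω | ∃ s ∈ (S : Set (Fin n)), ∃ t ∈ openCluster (ω ∩ {e | ∀ x ∈ e, x ∉ (S : Set (Fin n))}) b, s(s, t) ∈ ω} with hEXb
  set EXc : Set (BondConfig (Fin n)) :=
    {ω | ∃ s ∈ (S : Set (Fin n)), ∃ t ∈ openCluster (ω ∩ {e | ∀ x ∈ e, x ∉ (S : Set (Fin n))}) c, s(s, t) ∈ ω} with hEXc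
  have hD0' : {ω : BondConfig (Fin n) | b ∉ openCluster (ω ∩ {e | ∀ x ∈ e, x ∉ (S : Set (Fin n))}) c} = D0 := by
    ext ω; simp only [hD0, Set.mem_setOf_eq]; rw [mem_offSet_comm]
  rw [hD0']
  -- u0 = m - (A + G - X), uab = A - X, uac = G - X
  have hu0 : (prodBernoulli w).real (D0 ∩ (EXb ∪ EXc)ᶜ) = (prodBernoulli w).real D0 - (prodBernoulli w).real (D0 ∩ (EXb ∪ EXc)) := by
    have hset : D0 ∩ (EXb ∪ EXc)ᶜ = D0 \ (D0 ∩ (EXb ∪ EXc)) := by rw [Set.sdiff_self_inter, Set.sdiff_eq]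
    rw [hset, measureReal_sdiff Set.inter_subset_left (hm _)]
  have hunion : (prodBernoulli w).real (D0 ∩ (EXb ∪ EXc)) = (prodBernoulli w).real (D0 ∩ EXb) + (prodBernoulli w).real (D0 ∩ EXc) - (prodBernoulli w).real (D0 ∩ (EXb ∩ EXc)) := by
    have h := measureReal_union_add_inter (μ := prodBernoulli w) (s := D0 ∩ EXb) (t := D0 ∩ EXc) (hm _)
    have h1 : D0 ∩ EXb ∪ D0 ∩ EXc = D0 ∩ (EXb ∪ EXc) := (Set.inter_union_distrib_left _ _ _).symm
    have h2 : D0 ∩ EXb ∩ (D0 ∩ EXc) = D0 ∩ (EXb ∩ EXc) := by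
      ext ω; simp only [Set.mem_inter_iff]; tauto
    rw [h1, h2] at h
    linarith
  have hab : (prodBernoulli w).real (D0 ∩ (EXb ∩ EXcᶜ)) = (prodBernoulli w).real (D0 ∩ EXb) - (prodBernoulli w).real (D0 ∩ (EXb ∩ EXc)) := by
    have hset : D0 ∩ (EXb ∩ EXcᶜ) = (D0 ∩ EXb) \ (D0 ∩ (EXb ∩ EXc)) := by
      ext ω; simp only [Set.mem_inter_iff, Set.mem_compl_iff, Set.mem_sdiff]; tauto
    have hsub : D0 ∩ (EXb ∩ EXc) ⊆ D0 ∩ EXb := fun ω h => ⟨h.1, h.2.1⟩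
    rw [hset, measureReal_sdiff hsub (hm _)]
  have hac : (prodBernoulli w).real (D0 ∩ (EXc ∩ EXbᶜ)) = (prodBernoulli w).real (D0 ∩ EXc) - (prodBernoulli w).real (D0 ∩ (EXb ∩ EXc)) := by
    have hset : D0 ∩ (EXc ∩ EXbᶜ) = (D0 ∩ EXc) \ (D0 ∩ (EXb ∩ EXc)) := by
      ext ω; simp only [Set.mem_inter_iff, Set.mem_compl_iff, Set.mem_sdiff]; tauto
    have hsub : D0 ∩ (EXb ∩ EXc) ⊆ D0 ∩ EXc := fun ω h => ⟨h.1, h.2.2⟩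
    rw [hset, measureReal_sdiff hsub (hm _)]
  rw [hu0, hunion, hab, hac]
  have halg : ((prodBernoulli w).real D0 - ((prodBernoulli w).real (D0 ∩ EXb) + (prodBernoulli w).real (D0 ∩ EXc) - (prodBernoulli w).real (D0 ∩ (EXb ∩ EXc)))) *
        (prodBernoulli w).real (D0 ∩ (EXb ∩ EXc)) -
      ((prodBernoulli w).real (D0 ∩ EXb) - (prodBernoulli w).real (D0 ∩ (EXb ∩ EXc))) * ((prodBernoulli w).real (D0 ∩ EXc) - (prodBernoulli w).real (D0 ∩ (EXb ∩ EXc))) =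
      (prodBernoulli w).real D0 * (prodBernoulli w).real (D0 ∩ (EXb ∩ EXc)) - (prodBernoulli w).real (D0 ∩ EXb) * (prodBernoulli w).real (D0 ∩ EXc) := by ring
  linarith [key, halg]

end Main

end APL

end Summit.CriticalPhenomena.PercolationContinuityZ3.Theorems

end
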